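import Literature.Analysis.Distribution.EllipticRegularity
import Literature.Analysis.Distribution.FieldIntegrationByParts
import Mathlib.Analysis.Calculus.BumpFunction.FiniteDimension
import Mathlib.Analysis.Distribution.AEEqOfIntegralContDiff
import HarnessLib

/-!
# Elliptic operators reproduce their solutions against a smooth compactly supported kernel
(from Folland's local solvability and elliptic regularity)

Topic `Analysis/Distribution`; sequel of `EllipticRegularity` (the named facts
`Folland1995_thm845` — local solvability of elliptic equations in `𝓓'` — and `Folland1995_cor634` —
elliptic operators with smooth coefficients are hypoelliptic) and of `FieldIntegrationByParts`
(`∫ (Xf) g = ∫ f (ᵗX g)`). Let `P = ∑_{w ∈ S} a_w X_w` be a linear differential operator with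
smooth coefficients on a finite-dimensional real vector space `E` (presentation `(X, S, a)`:
smooth vector fields `X i`, words `w`, smooth coefficients `a_w`; `smoothDiffOp`), elliptic of
order `k` on an open set `Ω ∋ x₀`. This file PROVES, on the two named facts:

* `exists_kernel_of_isEllipticOn` — **the reproducing kernel**: there are an open `U ∋ x₀`,
  `U ⊆ Ω`, and `α ∈ C_c^∞(E)` supported in `U` such that EVERY smooth `v` with `P v = 0` on `U`
  satisfies `v(x₀) = ∫ α v dμ` (`μ` Lebesgue measure). Classical proof (e.g. the proof of the
  mean-value property of solutions of elliptic equations from a fundamental solution; Folland 1995,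
  proof of Thm. (8.45) and Cor. (6.34); Harish-Chandra 1966 / Borel 1972, 3.18, for `Z(𝔤)`-finite
  `K`-finite functions): the formal transpose `ᵗP` is again elliptic, so by (8.45) there is a
  distribution `u₀` on some `U ∋ x₀` with `ᵗP u₀ = δ_{x₀}`, which by (6.34) is a smooth function `h`
  off `x₀`; for a cut-off `χ ∈ C_c^∞(U)`, `χ = 1` near `x₀`, and a solution `v`:
  `v(x₀) = ⟨u₀, P(χ v)⟩ = ∫ h P(χ v) = ∫ ᵗP(η h) · χ v` (the test function `P(χ v)` lives in an
  annulus around `x₀` where `u₀ = h`, `η` a cut-off of that annulus), so `α = χ · ᵗP(η h)`.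

On the way (all proved, reusable):

* locality and additivity of `wordDeriv`/`smoothDiffOp` (`wordDeriv_eventuallyEq`,
  `smoothDiffOp_eventuallyEq`, `wordDeriv_add`, …);
* `integral_wordDeriv_mul`, `integral_smoothDiffOp_mul(')` — **`∫ (P f) g dμ = ∫ f (ᵗP g) dμ`**
  for smooth `f, g`, one of them compactly supported;
* `exists_smoothDiffOp_transpose` — **the formal transpose of a smooth presentation is a smooth
  presentation of the same order with principal symbol `(-1)^k σ_k`** (so `ᵗP` is elliptic when
  `P` is), via the explicit recursion `transposeTerms`
  (`ᵗX_i (c g) = (-(X_i c) - (div X_i) c) g + (-c) (X_i g)`);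
* `smoothDiffOpTranspose_eq_of_transpose` — `ᵗ(ᵗP) = P` on smooth functions (integration by
  parts and the fundamental lemma of the calculus of variations).

No definitions besides the auxiliary presentations `listOp`, `listTop`, `transposeTerms`,
`coeffOfList`; no named facts.

## References

* G. B. Folland, *Introduction to Partial Differential Equations*, 2nd ed. (1995), Cor. (6.34),
  Thm. (8.45) [Folland2020].
* L. Hörmander, *The Analysis of Linear Partial Differential Operators I*, 2nd ed. (1990),
  §11.1 (hypoellipticity) [folklore].
-/

noncomputable section

open MeasureTheory TopologicalSpace Set Function Filter Distributions
open scoped ContDiff Topology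

namespace Literature.Analysis.Distribution

variable {E : Type*} [NormedAddCommGroup E] [NormedSpace ℝ E] {ι : Type*}

/-! ### Locality and additivity of words and operators -/

section Locality

variable (X : ι → E → E)

omit [NormedSpace ℝ E] in
/-- helper: `1 ≤ ∞` in `WithTop ℕ∞`. [folklore] -/
private theorem one_le_infty : (1 : WithTop ℕ∞) ≤ ∞ := by exact_mod_cast le_top

/-- `X f` only depends on the germ of `f`. [folklore] -/
theorem fieldDeriv_eventuallyEq (Y : E → E) {f g : E → ℝ} {x : E} (h : f =ᶠ[𝓝 x] g) :
    fieldDeriv Y f =ᶠ[𝓝 x] fieldDeriv Y g := by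
  filter_upwards [h.fderiv (𝕜 := ℝ)] with y hy
  simp only [fieldDeriv_apply, hy]

/-- `X_w f` only depends on the germ of `f`. [folklore] -/
theorem wordDeriv_eventuallyEq (w : List ι) {f g : E → ℝ} {x : E} (h : f =ᶠ[𝓝 x] g) :
    wordDeriv X w f =ᶠ[𝓝 x] wordDeriv X w g := by
  induction w with
  | nil => simpa using h
  | cons i w ih => simpa using fieldDeriv_eventuallyEq (X i) ih

/-- `P f` only depends on the germ of `f`. [folklore] -/
theorem smoothDiffOp_eventuallyEq (S : Finset (List ι)) (a : List ι → E → ℝ) {f g : E → ℝ}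
    {x : E} (h : f =ᶠ[𝓝 x] g) : smoothDiffOp X S a f =ᶠ[𝓝 x] smoothDiffOp X S a g := by
  have hall : ∀ᶠ y in 𝓝 x, ∀ w ∈ S, wordDeriv X w f y = wordDeriv X w g y :=
    (S.eventually_all).2 fun w _ => wordDeriv_eventuallyEq X w h
  filter_upwards [hall] with y hy
  unfold smoothDiffOp
  exact Finset.sum_congr rfl fun w hw => by rw [hy w hw]

/-- If `f = g` on an open set `U` then `P f = P g` on `U`. [folklore] -/
theorem smoothDiffOp_eqOn (S : Finset (List ι)) (a : List ι → E → ℝ) {f g : E → ℝ} {U : Set E}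
    (hU : IsOpen U) (h : EqOn f g U) : EqOn (smoothDiffOp X S a f) (smoothDiffOp X S a g) U :=
  fun _ hx => (smoothDiffOp_eventuallyEq X S a (h.eventuallyEq_of_mem (hU.mem_nhds hx))).eq_of_nhds

/-- `X_w 0 = 0`. [folklore] -/
@[simp] theorem wordDeriv_zero (w : List ι) : wordDeriv X w (0 : E → ℝ) = 0 := by
  induction w with
  | nil => rfl
  | cons i w ih =>
    funext y
    rw [wordDeriv_cons, ih]
    simp [fieldDeriv]

/-- If `f = 0` near `x` then `P f x = 0`. [folklore] -/
theorem smoothDiffOp_eq_zero_of_eventuallyEq_zero (S : Finset (List ι)) (a : List ι → E → ℝ)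
    {f : E → ℝ} {x : E} (h : f =ᶠ[𝓝 x] 0) : smoothDiffOp X S a f x = 0 := by
  rw [(smoothDiffOp_eventuallyEq X S a h).eq_of_nhds]
  unfold smoothDiffOp
  refine Finset.sum_eq_zero fun w _ => ?_
  rw [wordDeriv_zero, Pi.zero_apply, mul_zero]

variable {X}

/-- `X (f + g) = X f + X g` for differentiable `f, g`. [folklore] -/
theorem fieldDeriv_add (Y : E → E) {f g : E → ℝ} (hf : Differentiable ℝ f)
    (hg : Differentiable ℝ g) : fieldDeriv Y (f + g) = fieldDeriv Y f + fieldDeriv Y g := by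
  funext x
  simp only [fieldDeriv_apply, Pi.add_apply, fderiv_add (hf x) (hg x), add_apply]

/-- `X (c f) = (X c) f + c (X f)` for differentiable `c, f`. [folklore] -/
theorem fieldDeriv_mul (Y : E → E) {c f : E → ℝ} (hc : Differentiable ℝ c)
    (hf : Differentiable ℝ f) :
    fieldDeriv Y (fun x => c x * f x) = fun x => fieldDeriv Y c x * f x + c x * fieldDeriv Y f x := by
  funext x
  simp only [fieldDeriv_apply, fderiv_fun_mul (hc x) (hf x), add_apply, smul_apply, smul_eq_mul]
  ring

/-- `X (r f) = r X f` for a constant `r`. [folklore] -/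
theorem fieldDeriv_const_mul (Y : E → E) (r : ℝ) (f : E → ℝ) :
    fieldDeriv Y (fun x => r * f x) = fun x => r * fieldDeriv Y f x := by
  funext x
  simp only [fieldDeriv_apply]
  rw [show (fun x => r * f x) = r • f from rfl, fderiv_const_smul_field, Pi.smul_apply, smul_apply,
    smul_eq_mul]

/-- `X_w (f + g) = X_w f + X_w g` for smooth data. [folklore] -/
theorem wordDeriv_add (hX : ∀ i, ContDiff ℝ ∞ (X i)) (w : List ι) {f g : E → ℝ}
    (hf : ContDiff ℝ ∞ f) (hg : ContDiff ℝ ∞ g) :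
    wordDeriv X w (f + g) = wordDeriv X w f + wordDeriv X w g := by
  induction w with
  | nil => rfl
  | cons i w ih =>
    rw [wordDeriv_cons, ih, wordDeriv_cons, wordDeriv_cons]
    exact fieldDeriv_add (X i)
      ((contDiff_wordDeriv hX w hf).differentiable (by simp))
      ((contDiff_wordDeriv hX w hg).differentiable (by simp))

/-- `X_w (r f) = r X_w f` for a constant `r`. [folklore] -/
theorem wordDeriv_const_mul (w : List ι) (r : ℝ) (f : E → ℝ) :
    wordDeriv X w (fun x => r * f x) = fun x => r * wordDeriv X w f x := by
  induction w with
  | nil => rfl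
  | cons i w ih => rw [wordDeriv_cons, ih, fieldDeriv_const_mul, wordDeriv_cons]

/-- `X_w (-f) = - X_w f`. [folklore] -/
theorem wordDeriv_neg (w : List ι) (f : E → ℝ) : wordDeriv X w (-f) = -wordDeriv X w f := by
  have h := wordDeriv_const_mul (X := X) w (-1) f
  simp only [neg_mul, one_mul] at h
  exact h

/-- `P (f + g) = P f + P g` for smooth data. [folklore] -/
theorem smoothDiffOp_add (hX : ∀ i, ContDiff ℝ ∞ (X i)) (S : Finset (List ι)) (a : List ι → E → ℝ)
    {f g : E → ℝ} (hf : ContDiff ℝ ∞ f) (hg : ContDiff ℝ ∞ g) :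
    smoothDiffOp X S a (f + g) = smoothDiffOp X S a f + smoothDiffOp X S a g := by
  funext x
  simp only [smoothDiffOp, Pi.add_apply, wordDeriv_add hX _ hf hg, mul_add, Finset.sum_add_distrib]

/-- `P (r f) = r P f` for a constant `r`. [folklore] -/
theorem smoothDiffOp_const_mul (S : Finset (List ι)) (a : List ι → E → ℝ) (r : ℝ) (f : E → ℝ) :
    smoothDiffOp X S a (fun x => r * f x) = fun x => r * smoothDiffOp X S a f x := by
  funext x
  simp only [smoothDiffOp, wordDeriv_const_mul, Finset.mul_sum]
  exact Finset.sum_congr rfl fun w _ => by ring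

/-- `P f` is smooth for smooth data. [folklore] -/
theorem contDiff_smoothDiffOp (hX : ∀ i, ContDiff ℝ ∞ (X i)) {S : Finset (List ι)}
    {a : List ι → E → ℝ} (ha : ∀ w ∈ S, ContDiff ℝ ∞ (a w)) {f : E → ℝ} (hf : ContDiff ℝ ∞ f) :
    ContDiff ℝ ∞ (smoothDiffOp X S a f) := by
  unfold smoothDiffOp
  exact ContDiff.sum fun w hw => (ha w hw).mul (contDiff_wordDeriv hX w hf)

/-- `ᵗX (f + g) = ᵗX f + ᵗX g` for differentiable data. [folklore] -/
theorem fieldTranspose_add (Y : E → E) {f g : E → ℝ} (hf : Differentiable ℝ f)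
    (hg : Differentiable ℝ g) :
    fieldTranspose Y (f + g) = fieldTranspose Y f + fieldTranspose Y g := by
  funext x
  simp only [fieldTranspose, fieldDeriv_add Y hf hg, Pi.add_apply]
  ring

variable [FiniteDimensional ℝ E]

/-- `ᵗ(X_w) (f + g) = ᵗ(X_w) f + ᵗ(X_w) g` for smooth data. [folklore] -/
theorem wordTranspose_add (hX : ∀ i, ContDiff ℝ ∞ (X i)) (w : List ι) {f g : E → ℝ}
    (hf : ContDiff ℝ ∞ f) (hg : ContDiff ℝ ∞ g) :
    wordTranspose X w (f + g) = wordTranspose X w f + wordTranspose X w g := by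
  induction w generalizing f g with
  | nil => rfl
  | cons i w ih =>
    rw [wordTranspose_cons, fieldTranspose_add (X i) (hf.differentiable (by simp))
      (hg.differentiable (by simp)), ih (contDiff_fieldTranspose (hX i) hf)
      (contDiff_fieldTranspose (hX i) hg), wordTranspose_cons, wordTranspose_cons]

end Locality

/-! ### Integration by parts: `∫ (X_w f) g = ∫ f (ᵗX_w g)` and `∫ (P f) g = ∫ f (ᵗP g)` -/

section IBP

variable [FiniteDimensional ℝ E] [MeasurableSpace E] [BorelSpace E] {μ : Measure E}
  [μ.IsAddHaarMeasure] {X : ι → E → E}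

/-- `∫ (X_w f) g dμ = ∫ f (ᵗ(X_w) g) dμ` for smooth `f, g` with `g` compactly supported.
[folklore] -/
theorem integral_wordDeriv_mul (hX : ∀ i, ContDiff ℝ ∞ (X i)) (w : List ι) {f g : E → ℝ}
    (hf : ContDiff ℝ ∞ f) (hg : ContDiff ℝ ∞ g) (hgc : HasCompactSupport g) :
    ∫ x, wordDeriv X w f x * g x ∂μ = ∫ x, f x * wordTranspose X w g x ∂μ := by
  induction w generalizing g with
  | nil => rfl
  | cons i w ih =>
    simp only [wordDeriv_cons, wordTranspose_cons]
    rw [integral_fieldDeriv_mul' ((hX i).of_le one_le_infty)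
      ((contDiff_wordDeriv hX w hf).of_le one_le_infty) (hg.of_le one_le_infty) hgc]
    exact ih (contDiff_fieldTranspose (hX i) hg)
      (hgc.mono' ((subset_tsupport _).trans (tsupport_fieldTranspose_subset (X i) g)))

/-- `∫ (X_w f) g dμ = ∫ f (ᵗ(X_w) g) dμ` for smooth `f, g` with `f` compactly supported.
[folklore] -/
theorem integral_wordDeriv_mul' (hX : ∀ i, ContDiff ℝ ∞ (X i)) (w : List ι) {f g : E → ℝ}
    (hf : ContDiff ℝ ∞ f) (hg : ContDiff ℝ ∞ g) (hfc : HasCompactSupport f) :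
    ∫ x, wordDeriv X w f x * g x ∂μ = ∫ x, f x * wordTranspose X w g x ∂μ := by
  induction w generalizing g with
  | nil => rfl
  | cons i w ih =>
    simp only [wordDeriv_cons, wordTranspose_cons]
    rw [integral_fieldDeriv_mul ((hX i).of_le one_le_infty)
      ((contDiff_wordDeriv hX w hf).of_le one_le_infty) (hg.of_le one_le_infty)
      (hfc.mono' ((subset_tsupport _).trans (tsupport_wordDeriv_subset w f)))]
    exact ih (contDiff_fieldTranspose (hX i) hg)

/-- **`∫ (P f) g dμ = ∫ f (ᵗP g) dμ`** for a smooth presentation, smooth `f, g` and `g` compactly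
supported. [folklore] -/
theorem integral_smoothDiffOp_mul (hX : ∀ i, ContDiff ℝ ∞ (X i)) {S : Finset (List ι)}
    {a : List ι → E → ℝ} (ha : ∀ w ∈ S, ContDiff ℝ ∞ (a w)) {f g : E → ℝ} (hf : ContDiff ℝ ∞ f)
    (hg : ContDiff ℝ ∞ g) (hgc : HasCompactSupport g) :
    ∫ x, smoothDiffOp X S a f x * g x ∂μ = ∫ x, f x * smoothDiffOpTranspose X S a g x ∂μ := by
  have hterm : ∀ w ∈ S, ∫ x, a w x * wordDeriv X w f x * g x ∂μ =
      ∫ x, f x * wordTranspose X w (fun y => a w y * g y) x ∂μ := by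
    intro w hw
    have := integral_wordDeriv_mul (μ := μ) hX w hf ((ha w hw).mul hg) (hgc.mul_left)
    refine Eq.trans (integral_congr_ae (Eventually.of_forall fun x => ?_)) this
    simp only; ring
  have iL : ∀ w ∈ S, Integrable (fun x => a w x * wordDeriv X w f x * g x) μ := fun w hw =>
    (((ha w hw).continuous.mul (contDiff_wordDeriv hX w hf).continuous).mul
      hg.continuous).integrable_of_hasCompactSupport hgc.mul_left
  have iR : ∀ w ∈ S, Integrable (fun x => f x * wordTranspose X w (fun y => a w y * g y) x) μ :=
    fun w hw => (hf.continuous.mul (contDiff_wordTranspose hX w ((ha w hw).mul hg)).continuous)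
      |>.integrable_of_hasCompactSupport <| (hgc.mul_left (f := a w)).mono'
        ((subset_tsupport _).trans (tsupport_wordTranspose_subset w _)) |>.mul_left
  have eL : (fun x => smoothDiffOp X S a f x * g x) =
      fun x => ∑ w ∈ S, a w x * wordDeriv X w f x * g x := by
    funext x; simp only [smoothDiffOp, Finset.sum_mul]
  have eR : (fun x => f x * smoothDiffOpTranspose X S a g x) =
      fun x => ∑ w ∈ S, f x * wordTranspose X w (fun y => a w y * g y) x := by
    funext x; simp only [smoothDiffOpTranspose, Finset.mul_sum]
  rw [eL, eR, integral_finsetSum _ iL, integral_finsetSum _ iR]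
  exact Finset.sum_congr rfl hterm

/-- **`∫ (P f) g dμ = ∫ f (ᵗP g) dμ`** for a smooth presentation, smooth `f, g` and `f` compactly
supported. [folklore] -/
theorem integral_smoothDiffOp_mul' (hX : ∀ i, ContDiff ℝ ∞ (X i)) {S : Finset (List ι)}
    {a : List ι → E → ℝ} (ha : ∀ w ∈ S, ContDiff ℝ ∞ (a w)) {f g : E → ℝ} (hf : ContDiff ℝ ∞ f)
    (hg : ContDiff ℝ ∞ g) (hfc : HasCompactSupport f) :
    ∫ x, smoothDiffOp X S a f x * g x ∂μ = ∫ x, f x * smoothDiffOpTranspose X S a g x ∂μ := by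
  have hterm : ∀ w ∈ S, ∫ x, a w x * wordDeriv X w f x * g x ∂μ =
      ∫ x, f x * wordTranspose X w (fun y => a w y * g y) x ∂μ := by
    intro w hw
    have := integral_wordDeriv_mul' (μ := μ) hX w hf ((ha w hw).mul hg) hfc
    refine Eq.trans (integral_congr_ae (Eventually.of_forall fun x => ?_)) this
    simp only; ring
  have hwc : ∀ w, HasCompactSupport (wordDeriv X w f) := fun w =>
    hfc.mono' ((subset_tsupport _).trans (tsupport_wordDeriv_subset w f))
  have iL : ∀ w ∈ S, Integrable (fun x => a w x * wordDeriv X w f x * g x) μ := fun w hw =>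
    (((ha w hw).continuous.mul (contDiff_wordDeriv hX w hf).continuous).mul
      hg.continuous).integrable_of_hasCompactSupport ((hwc w).mul_left.mul_right)
  have iR : ∀ w ∈ S, Integrable (fun x => f x * wordTranspose X w (fun y => a w y * g y) x) μ :=
    fun w hw => (hf.continuous.mul (contDiff_wordTranspose hX w ((ha w hw).mul hg)).continuous)
      |>.integrable_of_hasCompactSupport hfc.mul_right
  have eL : (fun x => smoothDiffOp X S a f x * g x) =
      fun x => ∑ w ∈ S, a w x * wordDeriv X w f x * g x := by
    funext x; simp only [smoothDiffOp, Finset.sum_mul]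
  have eR : (fun x => f x * smoothDiffOpTranspose X S a g x) =
      fun x => ∑ w ∈ S, f x * wordTranspose X w (fun y => a w y * g y) x := by
    funext x; simp only [smoothDiffOpTranspose, Finset.mul_sum]
  rw [eL, eR, integral_finsetSum _ iL, integral_finsetSum _ iR]
  exact Finset.sum_congr rfl hterm

end IBP

/-! ### The formal transpose of a smooth presentation is a smooth presentation -/

section Transpose

variable (X : ι → E → E)

/-- The operator `g ↦ ∑_{(c, w) ∈ L} c · X_w g` presented by a finite LIST of terms `(c, w)`
(an auxiliary presentation in which sums are concatenations). [folklore] -/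
def listOp (L : List ((E → ℝ) × List ι)) (g : E → ℝ) (x : E) : ℝ :=
  (L.map fun p => p.1 x * wordDeriv X p.2 g x).sum

/-- The order-`k` symbol `∑_{(c, w) ∈ L, |w| = k} c(x) ∏_j ξ(X_{w_j}(x))` of a list presentation.
[folklore] -/
def listTop (L : List ((E → ℝ) × List ι)) (k : ℕ) (x : E) (ξ : E →L[ℝ] ℝ) : ℝ :=
  (L.map fun p => if p.2.length = k then p.1 x * (p.2.map fun i => ξ (X i x)).prod else 0).sum

/-- The terms of the formal transpose `ᵗ(X_w) (c ·)`, by the recursion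
`ᵗX_i (c g) = (-(X_i c) - (div X_i) c) g + (-c) (X_i g)`:
`transposeTerms c [] = [(c, [])]`,
`transposeTerms c (i :: w) = transposeTerms (-(X_i c) - (div X_i) c) w ++
  [(c', w' ++ [i]) for (c', w') ∈ transposeTerms (-c) w]`. [folklore] -/
def transposeTerms (c : E → ℝ) : List ι → List ((E → ℝ) × List ι)
  | [] => [(c, [])]
  | i :: w =>
      transposeTerms (fun x => -fieldDeriv (X i) c x - fieldDiv (X i) x * c x) w ++
        (transposeTerms (fun x => -c x) w).map fun p => (p.1, p.2 ++ [i])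

/-- `transposeTerms` on the empty word. [folklore] -/
@[simp] theorem transposeTerms_nil (c : E → ℝ) : transposeTerms X c ([] : List ι) = [(c, [])] :=
  rfl

/-- `transposeTerms` on `i :: w`. [folklore] -/
theorem transposeTerms_cons (c : E → ℝ) (i : ι) (w : List ι) :
    transposeTerms X c (i :: w) =
      transposeTerms X (fun x => -fieldDeriv (X i) c x - fieldDiv (X i) x * c x) w ++
        (transposeTerms X (fun x => -c x) w).map fun p => (p.1, p.2 ++ [i]) :=
  rfl

/-- The empty list presents `0`. [folklore] -/
@[simp] theorem listOp_nil (g : E → ℝ) (x : E) : listOp X [] g x = 0 := by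
  simp [listOp]

/-- `listOp` of `p :: L`. [folklore] -/
@[simp] theorem listOp_cons (p : (E → ℝ) × List ι) (L : List ((E → ℝ) × List ι)) (g : E → ℝ)
    (x : E) : listOp X (p :: L) g x = p.1 x * wordDeriv X p.2 g x + listOp X L g x := by
  simp [listOp]

/-- `listOp` is additive under concatenation. [folklore] -/
theorem listOp_append (L₁ L₂ : List ((E → ℝ) × List ι)) (g : E → ℝ) (x : E) :
    listOp X (L₁ ++ L₂) g x = listOp X L₁ g x + listOp X L₂ g x := by
  simp [listOp, List.sum_append]

/-- The empty list has zero symbol. [folklore] -/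
@[simp] theorem listTop_nil (k : ℕ) (x : E) (ξ : E →L[ℝ] ℝ) : listTop X [] k x ξ = 0 := by
  simp [listTop]

/-- `listTop` of `p :: L`. [folklore] -/
@[simp] theorem listTop_cons (p : (E → ℝ) × List ι) (L : List ((E → ℝ) × List ι)) (k : ℕ)
    (x : E) (ξ : E →L[ℝ] ℝ) : listTop X (p :: L) k x ξ =
      (if p.2.length = k then p.1 x * (p.2.map fun i => ξ (X i x)).prod else 0) +
        listTop X L k x ξ := by
  simp [listTop]

/-- `listTop` is additive under concatenation. [folklore] -/
theorem listTop_append (L₁ L₂ : List ((E → ℝ) × List ι)) (k : ℕ) (x : E) (ξ : E →L[ℝ] ℝ) :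
    listTop X (L₁ ++ L₂) k x ξ = listTop X L₁ k x ξ + listTop X L₂ k x ξ := by
  simp [listTop, List.sum_append]

/-- Appending the letter `i` to every word composes the list operator with `X_i` on the right:
`(∑ c X_{w ++ [i]}) g = (∑ c X_w) (X_i g)`. [folklore] -/
theorem listOp_map_append_singleton (L : List ((E → ℝ) × List ι)) (i : ι) (g : E → ℝ) (x : E) :
    listOp X (L.map fun p => (p.1, p.2 ++ [i])) g x = listOp X L (fieldDeriv (X i) g) x := by
  induction L with
  | nil => simp
  | cons p L ih =>
    rw [List.map_cons, listOp_cons, listOp_cons, ih, wordDeriv_append]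
    rfl

/-- The words of `transposeTerms X c w` are no longer than `w`. [folklore] -/
theorem length_le_of_mem_transposeTerms (c : E → ℝ) (w : List ι) :
    ∀ p ∈ transposeTerms X c w, p.2.length ≤ w.length := by
  induction w generalizing c with
  | nil =>
    intro p hp
    rw [transposeTerms_nil, List.mem_singleton] at hp
    simp [hp]
  | cons i w ih =>
    intro p hp
    rw [transposeTerms_cons, List.mem_append, List.mem_map] at hp
    rcases hp with hp | ⟨q, hq, rfl⟩
    · exact (ih _ p hp).trans (by simp)
    · simpa using ih _ q hq

/-- A list presentation all of whose words are shorter than `k` has zero symbol of order `k`.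
[folklore] -/
theorem listTop_eq_zero_of_length_lt {L : List ((E → ℝ) × List ι)} {k : ℕ}
    (h : ∀ p ∈ L, p.2.length < k) (x : E) (ξ : E →L[ℝ] ℝ) : listTop X L k x ξ = 0 := by
  induction L with
  | nil => simp
  | cons p L ih =>
    rw [listTop_cons, ih fun q hq => h q (List.mem_cons_of_mem _ hq), add_zero,
      if_neg (h p List.mem_cons_self).ne]

/-- Appending the letter `i` to every word multiplies the top symbol by `ξ(X_i)`. [folklore] -/
theorem listTop_map_append_singleton (L : List ((E → ℝ) × List ι)) (i : ι) (k : ℕ) (x : E)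
    (ξ : E →L[ℝ] ℝ) :
    listTop X (L.map fun p => (p.1, p.2 ++ [i])) (k + 1) x ξ = listTop X L k x ξ * ξ (X i x) := by
  induction L with
  | nil => simp
  | cons p L ih =>
    rw [List.map_cons, listTop_cons, listTop_cons, ih, add_mul]
    congr 1
    simp only [List.length_append, List.length_cons, List.length_nil, zero_add,
      add_left_inj, List.map_append, List.map_cons, List.map_nil, List.prod_append,
      List.prod_cons, List.prod_nil, mul_one]
    split_ifs <;> ring

/-- **The symbol of the transpose terms**: the order-`|w|` symbol of `transposeTerms X c w` is
`(-1)^{|w|} c(x) ∏_j ξ(X_{w_j}(x))`. [folklore] -/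
theorem listTop_transposeTerms (c : E → ℝ) (w : List ι) (x : E) (ξ : E →L[ℝ] ℝ) :
    listTop X (transposeTerms X c w) w.length x ξ =
      (-1) ^ w.length * c x * (w.map fun i => ξ (X i x)).prod := by
  induction w generalizing c with
  | nil => simp [listTop]
  | cons i w ih =>
    rw [transposeTerms_cons, listTop_append]
    have h1 : listTop X
        (transposeTerms X (fun x => -fieldDeriv (X i) c x - fieldDiv (X i) x * c x) w)
        (i :: w).length x ξ = 0 :=
      listTop_eq_zero_of_length_lt X (fun p hp =>
        lt_of_le_of_lt (length_le_of_mem_transposeTerms X _ w p hp) (by simp)) x ξ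
    rw [h1, zero_add, List.length_cons, listTop_map_append_singleton, ih (fun x => -c x)]
    simp only [pow_succ, List.map_cons, List.prod_cons]
    ring

variable {X}

variable [FiniteDimensional ℝ E]

/-- The coefficients of `transposeTerms X c w` are smooth for smooth data. [folklore] -/
theorem contDiff_of_mem_transposeTerms (hX : ∀ i, ContDiff ℝ ∞ (X i)) {c : E → ℝ}
    (hc : ContDiff ℝ ∞ c) (w : List ι) : ∀ p ∈ transposeTerms X c w, ContDiff ℝ ∞ p.1 := by
  induction w generalizing c with
  | nil =>
    intro p hp
    rw [transposeTerms_nil, List.mem_singleton] at hp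
    simpa [hp] using hc
  | cons i w ih =>
    intro p hp
    rw [transposeTerms_cons, List.mem_append, List.mem_map] at hp
    rcases hp with hp | ⟨q, hq, rfl⟩
    · exact ih ((contDiff_fieldDeriv (hX i) hc).neg.sub ((contDiff_fieldDiv (hX i)).mul hc)) p hp
    · exact ih (c := fun x => -c x) hc.neg q hq

/-- **The transpose terms present the formal transpose**:
`(∑_{(c', w') ∈ transposeTerms X c w} c' X_{w'}) g = ᵗ(X_w) (c g)` for smooth `c, g`. [folklore] -/
theorem listOp_transposeTerms (hX : ∀ i, ContDiff ℝ ∞ (X i)) {c : E → ℝ} (hc : ContDiff ℝ ∞ c)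
    (w : List ι) {g : E → ℝ} (hg : ContDiff ℝ ∞ g) (x : E) :
    listOp X (transposeTerms X c w) g x = wordTranspose X w (fun y => c y * g y) x := by
  induction w generalizing c g x with
  | nil => simp [listOp]
  | cons i w ih =>
    have hd : ∀ {f : E → ℝ}, ContDiff ℝ ∞ f → Differentiable ℝ f := fun h =>
      h.differentiable (by simp)
    -- `ᵗX_i (c g) = c₁ g + (-c) (X_i g)`
    set c₁ : E → ℝ := fun x => -fieldDeriv (X i) c x - fieldDiv (X i) x * c x with hc₁_def
    have hc₁ : ContDiff ℝ ∞ c₁ :=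
      (contDiff_fieldDeriv (hX i) hc).neg.sub ((contDiff_fieldDiv (hX i)).mul hc)
    have hXg : ContDiff ℝ ∞ (fieldDeriv (X i) g) := contDiff_fieldDeriv (hX i) hg
    have hsplit : fieldTranspose (X i) (fun y => c y * g y) =
        (fun y => c₁ y * g y) + fun y => (-c y) * fieldDeriv (X i) g y := by
      funext y
      simp only [fieldTranspose, fieldDeriv_mul (X i) (hd hc) (hd hg), Pi.add_apply, hc₁_def]
      ring
    rw [transposeTerms_cons, listOp_append, listOp_map_append_singleton, ih hc₁ hg x,
      ih (c := fun x => -c x) hc.neg hXg x, wordTranspose_cons, hsplit,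
      wordTranspose_add hX w (hc₁.mul hg) (hc.neg.mul hXg), Pi.add_apply]

/-- The coefficient function `a_w = ∑_{(c, w') ∈ L, w' = w} c` of the word `w` in a list
presentation. [folklore] -/
def coeffOfList [DecidableEq ι] (L : List ((E → ℝ) × List ι)) (w : List ι) (x : E) : ℝ :=
  (L.map fun p => if p.2 = w then p.1 x else 0).sum

omit [NormedAddCommGroup E] [NormedSpace ℝ E] [FiniteDimensional ℝ E] in
/-- The empty list has zero coefficients. [folklore] -/
@[simp] theorem coeffOfList_nil [DecidableEq ι] (w : List ι) (x : E) :
    coeffOfList ([] : List ((E → ℝ) × List ι)) w x = 0 := by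
  simp [coeffOfList]

omit [NormedAddCommGroup E] [NormedSpace ℝ E] [FiniteDimensional ℝ E] in
/-- The coefficients of `p :: L`. [folklore] -/
@[simp] theorem coeffOfList_cons [DecidableEq ι] (p : (E → ℝ) × List ι)
    (L : List ((E → ℝ) × List ι)) (w : List ι) (x : E) :
    coeffOfList (p :: L) w x = (if p.2 = w then p.1 x else 0) + coeffOfList L w x := by
  simp [coeffOfList]

omit [FiniteDimensional ℝ E] in
/-- A list presentation and its word-indexed regrouping define the same operator. [folklore] -/
theorem smoothDiffOp_coeffOfList [DecidableEq ι] (L : List ((E → ℝ) × List ι))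
    {S : Finset (List ι)} (hS : ∀ p ∈ L, p.2 ∈ S) (g : E → ℝ) (x : E) :
    smoothDiffOp X S (coeffOfList L) g x = listOp X L g x := by
  induction L with
  | nil => simp [smoothDiffOp]
  | cons p L ih =>
    have hp : p.2 ∈ S := hS p List.mem_cons_self
    have ih' := ih fun q hq => hS q (List.mem_cons_of_mem _ hq)
    rw [listOp_cons, ← ih']
    simp only [smoothDiffOp, coeffOfList_cons, add_mul, Finset.sum_add_distrib, ite_mul, zero_mul]
    rw [Finset.sum_ite_eq S p.2, if_pos hp]

omit [FiniteDimensional ℝ E] in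
/-- A list presentation and its word-indexed regrouping have the same symbols. [folklore] -/
theorem principalSymbol_coeffOfList [DecidableEq ι] (L : List ((E → ℝ) × List ι))
    {S : Finset (List ι)} (hS : ∀ p ∈ L, p.2 ∈ S) (k : ℕ) (x : E) (ξ : E →L[ℝ] ℝ) :
    principalSymbol X S (coeffOfList L) k x ξ = listTop X L k x ξ := by
  induction L with
  | nil => simp [principalSymbol]
  | cons p L ih =>
    have hp : p.2 ∈ S := hS p List.mem_cons_self
    have ih' := ih fun q hq => hS q (List.mem_cons_of_mem _ hq)
    rw [listTop_cons, ← ih']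
    simp only [principalSymbol, coeffOfList_cons, add_mul, Finset.sum_add_distrib]
    congr 1
    rw [show (∑ w ∈ S with w.length = k,
        (if p.2 = w then p.1 x else 0) * (w.map fun i => ξ (X i x)).prod) =
        ∑ w ∈ S with w.length = k,
          (if p.2 = w then p.1 x * (w.map fun i => ξ (X i x)).prod else 0) from
      Finset.sum_congr rfl fun w _ => by split_ifs <;> simp, Finset.sum_ite_eq]
    simp only [Finset.mem_filter, hp, true_and]

omit [FiniteDimensional ℝ E] in
/-- The regrouped coefficients are smooth when the terms are. [folklore] -/
theorem contDiff_coeffOfList [DecidableEq ι] {L : List ((E → ℝ) × List ι)}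
    (hL : ∀ p ∈ L, ContDiff ℝ ∞ p.1) (w : List ι) : ContDiff ℝ ∞ (coeffOfList L w) := by
  induction L with
  | nil =>
    rw [show coeffOfList ([] : List ((E → ℝ) × List ι)) w = 0 from funext fun x => by simp]
    exact contDiff_const
  | cons p L ih =>
    have h : coeffOfList (p :: L) w = (fun x => if p.2 = w then p.1 x else 0) + coeffOfList L w := by
      funext x; rw [coeffOfList_cons]; rfl
    rw [h]
    refine ContDiff.add ?_ (ih fun q hq => hL q (List.mem_cons_of_mem _ hq))
    split_ifs
    · exact hL p List.mem_cons_self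
    · exact contDiff_const

end Transpose

/-! ### The transpose presentation and the double transpose -/

section TransposeMain

variable {X : ι → E → E} [FiniteDimensional ℝ E]

omit [FiniteDimensional ℝ E] in
/-- `listOp` of a concatenation of families of terms is the sum of the `listOp`s. [folklore] -/
theorem listOp_flatMap {κ : Type*} (l : List κ) (F : κ → List ((E → ℝ) × List ι)) (g : E → ℝ)
    (x : E) : listOp X (l.flatMap F) g x = (l.map fun w => listOp X (F w) g x).sum := by
  induction l with
  | nil => simp
  | cons w l ih => rw [List.flatMap_cons, listOp_append, ih, List.map_cons, List.sum_cons]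

omit [FiniteDimensional ℝ E] in
/-- `listTop` of a concatenation of families of terms is the sum of the `listTop`s. [folklore] -/
theorem listTop_flatMap {κ : Type*} (l : List κ) (F : κ → List ((E → ℝ) × List ι)) (k : ℕ)
    (x : E) (ξ : E →L[ℝ] ℝ) :
    listTop X (l.flatMap F) k x ξ = (l.map fun w => listTop X (F w) k x ξ).sum := by
  induction l with
  | nil => simp
  | cons w l ih => rw [List.flatMap_cons, listTop_append, ih, List.map_cons, List.sum_cons]

/-- **The formal transpose of a smooth presentation is a smooth presentation of the same order,
with principal symbol `(-1)^k σ_k`.** For `P = ∑_{w ∈ S} a_w X_w` (smooth fields and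
coefficients, words of length `≤ k`) there is a presentation `(X, S', a')` of the same kind with
`∑_{w ∈ S'} a'_w X_w g = ᵗP g` for every smooth `g` and `σ_k(ᵗP) = (-1)^k σ_k(P)`; in particular
`ᵗP` is elliptic of order `k` wherever `P` is. Folland 1995, Ch. 6 §C (the transpose of
`∑ a_α ∂^α` is `∑ (-1)^{|α|} ∂^α (a_α ·)`, of the same order and principal symbol up to sign).
[cite: Folland2020, Ch. 6 §C, p. 210] -/
theorem exists_smoothDiffOp_transpose [DecidableEq ι] (hX : ∀ i, ContDiff ℝ ∞ (X i))
    {S : Finset (List ι)} {a : List ι → E → ℝ} (ha : ∀ w ∈ S, ContDiff ℝ ∞ (a w)) {k : ℕ}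
    (hk : ∀ w ∈ S, w.length ≤ k) :
    ∃ (S' : Finset (List ι)) (a' : List ι → E → ℝ),
      (∀ w ∈ S', ContDiff ℝ ∞ (a' w)) ∧ (∀ w ∈ S', w.length ≤ k) ∧
      (∀ g : E → ℝ, ContDiff ℝ ∞ g → smoothDiffOp X S' a' g = smoothDiffOpTranspose X S a g) ∧
      ∀ x ξ, principalSymbol X S' a' k x ξ = (-1) ^ k * principalSymbol X S a k x ξ := by
  -- all transpose terms, concatenated over `w ∈ S`, regrouped by words
  set L : List ((E → ℝ) × List ι) := S.toList.flatMap fun w => transposeTerms X (a w) w with hL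
  have hmem : ∀ p ∈ L, ∃ w ∈ S, p ∈ transposeTerms X (a w) w := fun p hp => by
    obtain ⟨w, hw, hpw⟩ := List.mem_flatMap.1 hp
    exact ⟨w, Finset.mem_toList.1 hw, hpw⟩
  set S' : Finset (List ι) := (L.map Prod.snd).toFinset with hS'
  have hS'L : ∀ p ∈ L, p.2 ∈ S' := fun p hp =>
    List.mem_toFinset.2 (List.mem_map.2 ⟨p, hp, rfl⟩)
  refine ⟨S', coeffOfList L, fun w _ => contDiff_coeffOfList (fun p hp => ?_) w, ?_, ?_, ?_⟩
  · obtain ⟨w, hw, hpw⟩ := hmem p hp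
    exact contDiff_of_mem_transposeTerms hX (ha w hw) w p hpw
  · intro w' hw'
    obtain ⟨p, hp, rfl⟩ := List.mem_map.1 (List.mem_toFinset.1 hw')
    obtain ⟨w, hw, hpw⟩ := hmem p hp
    exact (length_le_of_mem_transposeTerms X (a w) w p hpw).trans (hk w hw)
  · intro g hg
    funext x
    rw [smoothDiffOp_coeffOfList L hS'L g x, hL, listOp_flatMap]
    unfold smoothDiffOpTranspose
    rw [← Finset.sum_map_toList]
    refine congrArg List.sum (List.map_congr_left fun w hw => ?_)
    exact listOp_transposeTerms hX (ha w (Finset.mem_toList.1 hw)) w hg x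
  · intro x ξ
    rw [principalSymbol_coeffOfList L hS'L k x ξ, hL, listTop_flatMap]
    have hterm : ∀ w ∈ S, listTop X (transposeTerms X (a w) w) k x ξ =
        if w.length = k then (-1) ^ k * (a w x * (w.map fun i => ξ (X i x)).prod) else 0 := by
      intro w hw
      split_ifs with hwk
      · rw [← hwk, listTop_transposeTerms, mul_assoc]
      · exact listTop_eq_zero_of_length_lt X (fun p hp =>
          lt_of_le_of_lt (length_le_of_mem_transposeTerms X (a w) w p hp)
            (lt_of_le_of_ne (hk w hw) hwk)) x ξ
    rw [List.map_congr_left fun w hw => hterm w (Finset.mem_toList.1 hw), Finset.sum_map_toList,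
      ← Finset.sum_filter]
    unfold principalSymbol
    rw [Finset.mul_sum]

/-- **`ᵗ(ᵗP) = P` on smooth functions**: if `(X, S', a')` presents the formal transpose of
`P = (X, S, a)` on smooth functions, then the formal transpose of `(X, S', a')` is `P` on smooth
functions (integrate by parts twice against test functions and use the fundamental lemma of the
calculus of variations). [folklore] -/
theorem smoothDiffOpTranspose_eq_of_transpose (hX : ∀ i, ContDiff ℝ ∞ (X i))
    {S S' : Finset (List ι)} {a a' : List ι → E → ℝ} (ha : ∀ w ∈ S, ContDiff ℝ ∞ (a w))
    (ha' : ∀ w ∈ S', ContDiff ℝ ∞ (a' w))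
    (hP' : ∀ g : E → ℝ, ContDiff ℝ ∞ g → smoothDiffOp X S' a' g = smoothDiffOpTranspose X S a g)
    {φ : E → ℝ} (hφ : ContDiff ℝ ∞ φ) :
    smoothDiffOpTranspose X S' a' φ = smoothDiffOp X S a φ := by
  letI : MeasurableSpace E := borel E
  haveI : BorelSpace E := ⟨rfl⟩
  set μ : Measure E := Measure.addHaar
  have hc1 : Continuous (smoothDiffOpTranspose X S' a' φ) :=
    (contDiff_smoothDiffOpTranspose hX ha' hφ).continuous
  have hc2 : Continuous (smoothDiffOp X S a φ) := (contDiff_smoothDiffOp hX ha hφ).continuous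
  have hae : ∀ᵐ x ∂μ, smoothDiffOpTranspose X S' a' φ x = smoothDiffOp X S a φ x := by
    refine ae_eq_of_integral_contDiff_smul_eq (hc1.locallyIntegrable) (hc2.locallyIntegrable)
      fun g hg hgc => ?_
    simp only [smul_eq_mul]
    calc ∫ x, g x * smoothDiffOpTranspose X S' a' φ x ∂μ
        = ∫ x, smoothDiffOp X S' a' g x * φ x ∂μ :=
          (integral_smoothDiffOp_mul' hX ha' hg hφ hgc).symm
      _ = ∫ x, φ x * smoothDiffOpTranspose X S a g x ∂μ := by
          rw [hP' g hg]
          exact integral_congr_ae (Eventually.of_forall fun x => mul_comm _ _)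
      _ = ∫ x, smoothDiffOp X S a φ x * g x ∂μ := (integral_smoothDiffOp_mul hX ha hφ hg hgc).symm
      _ = ∫ x, g x * smoothDiffOp X S a φ x ∂μ :=
          integral_congr_ae (Eventually.of_forall fun x => mul_comm _ _)
  exact (Continuous.ae_eq_iff_eq μ hc1 hc2).1 hae

end TransposeMain

/-! ### The reproducing kernel -/

section Kernel

/-- **Solutions of an elliptic equation are reproduced by a smooth compactly supported kernel**
(on Folland's Thm. (8.45) and Cor. (6.34)). Let `P = ∑_{w ∈ S} a_w X_w` be a smooth presentation on a
finite-dimensional real vector space `E` of positive dimension, elliptic of order `k` on the open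
set `Ω ∋ x₀`, and `μ` an additive Haar measure. Then there are an open `U` with `x₀ ∈ U ⊆ Ω` and
`α ∈ C_c^∞(E)` with `supp α ⊆ U` such that `v(x₀) = ∫ α v dμ` for every smooth `v : E → ℝ` with
`P v = 0` on `U`. Proof: `ᵗP` is elliptic (`exists_smoothDiffOp_transpose`), so (8.45) gives
`u₀ ∈ 𝓓'(U)` with `ᵗP u₀ = δ_{x₀}` (`⟨u₀, P φ⟩ = φ(x₀)`, by `ᵗ(ᵗP) = P`), and (6.34) makes
`u₀` a smooth function `h` on `U ∖ {x₀}`; with a bump `χ` (`= 1` near `x₀`, supported in `U`) and a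
cut-off `η` of the annulus carrying `P(χ v)`:
`v(x₀) = ⟨u₀, P(χ v)⟩ = ∫ h P(χ v) = ∫ (η h) P(χ v) = ∫ ᵗP(η h) χ v`, i.e. `α = χ ᵗP(η h)`.
Folland 1995, Thm. (8.45), Cor. (6.34); classical (fundamental solutions reproduce solutions,
e.g. Harish-Chandra 1966, Thm. 1 / Borel 1972, 3.18 for `Z(𝔤)`-finite `K`-finite functions).
[cite: Folland2020, Thm. (8.45) and Cor. (6.34)] -/
theorem exists_kernel_of_isEllipticOn (h845 : Folland1995_thm845) (h634 : Folland1995_cor634)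
    {E : Type} [NormedAddCommGroup E] [NormedSpace ℝ E] [FiniteDimensional ℝ E] [Nontrivial E]
    [MeasurableSpace E] [BorelSpace E] (μ : Measure E) [μ.IsAddHaarMeasure]
    {ι : Type} [DecidableEq ι] {Ω : Opens E} {X : ι → E → E} {S : Finset (List ι)}
    {a : List ι → E → ℝ} {k : ℕ} (hX : ∀ i, ContDiff ℝ ∞ (X i)) (ha : ∀ w ∈ S, ContDiff ℝ ∞ (a w))
    (hell : IsEllipticOn X S a k (Ω : Set E)) {x₀ : E} (hx₀ : x₀ ∈ (Ω : Set E)) :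
    ∃ U : Opens E, x₀ ∈ U ∧ U ≤ Ω ∧ ∃ α : E → ℝ, ContDiff ℝ ∞ α ∧ HasCompactSupport α ∧
      tsupport α ⊆ (U : Set E) ∧
      ∀ v : E → ℝ, ContDiff ℝ ∞ v → (∀ x ∈ (U : Set E), smoothDiffOp X S a v x = 0) →
        v x₀ = ∫ x, α x * v x ∂μ := by
  -- Step 1: the transpose presentation `(X, S', a')` of `ᵗP`, elliptic of order `k` on `Ω`
  obtain ⟨S', a', ha', hk', hP', hsymb⟩ := exists_smoothDiffOp_transpose hX ha hell.1
  have hell' : IsEllipticOn X S' a' k (Ω : Set E) :=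
    ⟨hk', fun x hx ξ hξ => by
      rw [hsymb]
      exact mul_ne_zero (pow_ne_zero _ (by norm_num)) (hell.2 x hx ξ hξ)⟩
  have hPP : ∀ g : E → ℝ, ContDiff ℝ ∞ g → smoothDiffOpTranspose X S' a' g = smoothDiffOp X S a g :=
    fun g hg => smoothDiffOpTranspose_eq_of_transpose hX ha ha' hP' hg
  -- Step 2: (8.45) for `ᵗP` with right-hand side `δ_{x₀}`: `⟨u₀, P φ⟩ = φ x₀` on `U`
  obtain ⟨U, hxU, hUΩ, hsol⟩ := h845 E ι Ω X S' a' k hX ha' hell' x₀ hx₀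
  obtain ⟨u₀, hu₀⟩ := hsol (_root_.Distribution.delta x₀)
  have hu₀' : ∀ φ ψ : 𝓓(U, ℝ), (ψ : E → ℝ) = smoothDiffOp X S a φ → u₀ ψ = φ x₀ := by
    intro φ ψ hψ
    have h := hu₀ φ ψ (by rw [hψ, hPP φ φ.contDiff])
    rw [h, _root_.Distribution.delta_apply]
    change ((TestFunction.monoCLM ℝ φ : 𝓓(Ω, ℝ)) : E → ℝ) x₀ = φ x₀
    rw [TestFunction.monoCLM_apply, if_pos ⟨le_rfl, hUΩ⟩]
  -- Step 3: (6.34): `u₀` is a smooth function `h` on `U \ {x₀}`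
  set U' : Set E := (U : Set E) \ {x₀} with hU'
  have hU'o : IsOpen U' := U.isOpen.sdiff isClosed_singleton
  have hU'U : U' ⊆ (U : Set E) := fun x hx => hx.1
  have himg : Distribution.ImageIsSmoothOn u₀ (smoothDiffOpTranspose X S' a') μ U' := by
    refine ⟨0, contDiffOn_const, fun φ ψ hφ hψ => ?_⟩
    rw [hu₀' φ ψ (by rw [hψ, hPP φ φ.contDiff])]
    simp only [Pi.zero_apply, zero_mul, integral_zero]
    exact image_eq_zero_of_notMem_tsupport fun h => (hφ h).2 rfl
  obtain ⟨h, hh, hhu⟩ :=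
    h634 E μ ι U X S' a' k hX ha' ⟨hk', fun x hx => hell'.2 x (hUΩ hx)⟩ u₀ U' hU'o hU'U himg
  -- Step 4: radii and cut-offs
  obtain ⟨ε, hε, hεU⟩ := Metric.isOpen_iff.1 U.isOpen x₀ hxU
  set r : ℝ := ε / 8 with hr
  have hr0 : 0 < r := by positivity
  have h4r : Metric.closedBall x₀ (4 * r) ⊆ (U : Set E) := fun y hy => hεU (by
    rw [Metric.mem_closedBall] at hy
    rw [Metric.mem_ball]
    linarith)
  -- `χ = 1` on `closedBall x₀ r`, supported in `closedBall x₀ (2r)`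
  let χ : ContDiffBump x₀ := ⟨r, 2 * r, hr0, by linarith⟩
  -- `η = 1` on `r/2 ≤ dist ≤ 3r`, `η = 0` on `closedBall x₀ (r/4)`, supported in `closedBall x₀ (4r)`
  let χ₀ : ContDiffBump x₀ := ⟨r / 4, r / 2, by positivity, by linarith⟩
  let χ₃ : ContDiffBump x₀ := ⟨3 * r, 4 * r, by positivity, by linarith⟩
  set η : E → ℝ := fun x => χ₃ x * (1 - χ₀ x) with hη
  have hηs : ContDiff ℝ ∞ η := χ₃.contDiff.mul (contDiff_const.sub χ₀.contDiff)
  have hηc : HasCompactSupport η := χ₃.hasCompactSupport.mul_right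
  have hη_tsupp : tsupport η ⊆ Metric.closedBall x₀ (4 * r) := by
    refine (tsupport_mul_subset_left (f := (χ₃ : E → ℝ)) (g := fun x => 1 - χ₀ x)).trans ?_
    rw [χ₃.tsupport_eq]
  have hη_one : ∀ x, r / 2 ≤ dist x x₀ → dist x x₀ ≤ 3 * r → η x = 1 := by
    intro x h1 h2
    have e3 : χ₃ x = 1 := χ₃.one_of_mem_closedBall (by rw [Metric.mem_closedBall]; exact h2)
    have e0 : χ₀ x = 0 := χ₀.zero_of_le_dist (by exact h1)
    simp [hη, e3, e0]
  have hη_zero : ∀ x, dist x x₀ ≤ r / 4 → η x = 0 := by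
    intro x h1
    have e0 : χ₀ x = 1 := χ₀.one_of_mem_closedBall (by rw [Metric.mem_closedBall]; exact h1)
    simp [hη, e0]
  have hη_ev0 : ∀ x, x ∉ U' → η =ᶠ[𝓝 x] 0 := by
    intro x hx
    by_cases hxU : x ∈ (U : Set E)
    · have hx0 : x = x₀ := by
        by_contra hne
        exact hx ⟨hxU, hne⟩
      subst hx0
      filter_upwards [Metric.closedBall_mem_nhds x (by positivity : (0 : ℝ) < r / 4)] with y hy
      exact hη_zero y (by rwa [Metric.mem_closedBall] at hy)
    · have : x ∉ tsupport η := fun h => hxU (h4r (hη_tsupp h))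
      exact notMem_tsupport_iff_eventuallyEq.1 this
  -- `h' = η h ∈ C_c^∞(E)`
  set h' : E → ℝ := fun x => η x * h x with hh'
  have hh's : ContDiff ℝ ∞ h' := by
    refine contDiff_iff_contDiffAt.2 fun x => ?_
    by_cases hx : x ∈ U'
    · exact hηs.contDiffAt.mul (hh.contDiffAt (hU'o.mem_nhds hx))
    · have hev : h' =ᶠ[𝓝 x] fun _ => 0 := by
        filter_upwards [hη_ev0 x hx] with y hy
        simp [hh', hy]
      exact (contDiffAt_const (c := (0 : ℝ))).congr_of_eventuallyEq hev
  have hh'c : HasCompactSupport h' := hηc.mul_right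
  -- the kernel
  set α : E → ℝ := fun x => χ x * smoothDiffOpTranspose X S a h' x with hα
  have hαs : ContDiff ℝ ∞ α := χ.contDiff.mul (contDiff_smoothDiffOpTranspose hX ha hh's)
  have hαc : HasCompactSupport α := χ.hasCompactSupport.mul_right
  have hα_tsupp : tsupport α ⊆ (U : Set E) := by
    refine (tsupport_mul_subset_left (f := (χ : E → ℝ))
      (g := smoothDiffOpTranspose X S a h')).trans ?_
    rw [χ.tsupport_eq]
    exact (Metric.closedBall_subset_closedBall (by change 2 * r ≤ 4 * r; linarith)).trans h4r
  refine ⟨U, hxU, hUΩ, α, hαs, hαc, hα_tsupp, fun v hv hPv => ?_⟩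
  -- Step 5: the identity for a solution `v`
  set w : E → ℝ := fun x => χ x * v x with hw
  have hws : ContDiff ℝ ∞ w := χ.contDiff.mul hv
  have hwc : HasCompactSupport w := χ.hasCompactSupport.mul_right
  have hw_tsupp : tsupport w ⊆ Metric.closedBall x₀ (2 * r) := by
    refine (tsupport_mul_subset_left (f := (χ : E → ℝ)) (g := v)).trans ?_
    rw [χ.tsupport_eq]
  -- `P w` vanishes on `ball x₀ r` (where `w = v` locally and `P v = 0`) and off `closedBall x₀ (2r)`
  have hPw_ball : ∀ x ∈ Metric.ball x₀ r, smoothDiffOp X S a w x = 0 := by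
    intro x hx
    have hev : w =ᶠ[𝓝 x] v := by
      filter_upwards [Metric.isOpen_ball.mem_nhds hx] with y hy
      have : χ y = 1 := χ.one_of_mem_closedBall (Metric.ball_subset_closedBall hy)
      simp [hw, this]
    rw [(smoothDiffOp_eventuallyEq X S a hev).eq_of_nhds]
    exact hPv x (h4r (Metric.closedBall_subset_closedBall (by linarith)
      (Metric.ball_subset_closedBall hx)))
  have hPw_tsupp : tsupport (smoothDiffOp X S a w) ⊆ Metric.closedBall x₀ (2 * r) \ Metric.ball x₀ r := by
    intro x hx
    refine ⟨(tsupport_smoothDiffOp_subset S a w).trans hw_tsupp hx, fun hxb => ?_⟩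
    -- `P w = 0` on the open ball, so the ball misses the topological support
    have : x ∉ tsupport (smoothDiffOp X S a w) := by
      rw [notMem_tsupport_iff_eventuallyEq]
      filter_upwards [Metric.isOpen_ball.mem_nhds hxb] with y hy
      exact hPw_ball y hy
    exact this hx
  have hPws : ContDiff ℝ ∞ (smoothDiffOp X S a w) := contDiff_smoothDiffOp hX ha hws
  have hPwc : HasCompactSupport (smoothDiffOp X S a w) :=
    hwc.mono' ((subset_tsupport _).trans (tsupport_smoothDiffOp_subset S a w))
  have hPwU : tsupport (smoothDiffOp X S a w) ⊆ (U : Set E) := fun x hx =>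
    h4r (Metric.closedBall_subset_closedBall (by linarith) (hPw_tsupp hx).1)
  have hPwU' : tsupport (smoothDiffOp X S a w) ⊆ U' := fun x hx =>
    ⟨hPwU hx, fun hx0 => (hPw_tsupp hx).2 (by
      rw [mem_singleton_iff] at hx0
      rw [hx0]
      exact Metric.mem_ball_self hr0)⟩
  -- the test functions `w` and `P w` on `U`
  let φ₁ : 𝓓(U, ℝ) := ⟨w, hws, hwc, hw_tsupp.trans
    ((Metric.closedBall_subset_closedBall (by linarith)).trans h4r)⟩
  let ψ₁ : 𝓓(U, ℝ) := ⟨smoothDiffOp X S a w, hPws, hPwc, hPwU⟩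
  -- (a) `⟨u₀, P w⟩ = w x₀ = v x₀`
  have ha1 : u₀ ψ₁ = v x₀ := by
    rw [hu₀' φ₁ ψ₁ rfl]
    change χ x₀ * v x₀ = v x₀
    rw [χ.one_of_mem_closedBall (Metric.mem_closedBall_self hr0.le), one_mul]
  -- (b) `⟨u₀, P w⟩ = ∫ h (P w) = ∫ h' (P w)`
  have hb1 : u₀ ψ₁ = ∫ x, h' x * smoothDiffOp X S a w x ∂μ := by
    rw [hhu ψ₁ hPwU']
    refine integral_congr_ae (Eventually.of_forall fun x => ?_)
    change h x * smoothDiffOp X S a w x = η x * h x * smoothDiffOp X S a w x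
    by_cases hx : smoothDiffOp X S a w x = 0
    · simp [hx]
    · have hxK := hPw_tsupp (subset_tsupport _ hx)
      rw [hη_one x (by
          have := hxK.2
          rw [Metric.mem_ball, not_lt] at this
          linarith) (by
          have := hxK.1
          rw [Metric.mem_closedBall] at this
          linarith), one_mul]
  -- (c) integrate by parts: `∫ h' (P w) = ∫ w ᵗP h' = ∫ α v`
  have hc1 : ∫ x, h' x * smoothDiffOp X S a w x ∂μ = ∫ x, α x * v x ∂μ := by
    calc ∫ x, h' x * smoothDiffOp X S a w x ∂μ = ∫ x, smoothDiffOp X S a w x * h' x ∂μ :=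
          integral_congr_ae (Eventually.of_forall fun x => mul_comm _ _)
      _ = ∫ x, w x * smoothDiffOpTranspose X S a h' x ∂μ :=
          integral_smoothDiffOp_mul hX ha hws hh's hh'c
      _ = ∫ x, α x * v x ∂μ := integral_congr_ae (Eventually.of_forall fun x => by
          change χ x * v x * smoothDiffOpTranspose X S a h' x =
            χ x * smoothDiffOpTranspose X S a h' x * v x
          ring)
  rw [← ha1, hb1, hc1]

end Kernel



end Literature.Analysis.Distribution
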